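import Literature.NumberTheory.Automorphic.UnitaryGroupIsotropicVectorBoundedHeight
import HarnessLib

/-!
# Every isotropic rational vector of `(E², J₂)` is the last row of a rational unitary matrix;
# the Siegel domain `{H ≥ c₀}` covers `U(J₂)(F)\U(J₂)(𝔸_F)`

Topic `NumberTheory/Automorphic`; namespace `Literature.NumberTheory.Automorphic.UnitaryGroup`.
Proof file: theorems only (no definition, no named fact, no instance, no `sorry`); imports = tree.
The `N = 2` twin of ★ `UnitaryGroupRationalIsotropicLastRow` (rank-one quasi-split unitary group `U(J₂) = U(Φ₂)`
of the quadratic extension `E/F` with involution `c`, `c * c = 1`, `J₂ = antidiag(1, 1)`, hermitian form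
`⟨ξ, η⟩ = ξ₀ c(η₁) + ξ₁ c(η₀)` on `E²`; rational points `(quasiSplit F E c 2).Rational`; Iwasawa / Borel height
`H = borelHeight`, `H(g) = h(e₂ g)⁻¹`, typed at every `N` in ★ `UnitaryGroupBorelHeight`). H-side copy of the LAW
trunk of `Cruxes/H413/Lines/F0_T1InnerFormTraceIdentity.lean` for the endoscopic group `H = U(Φ₂) × U(Φ₁)` (cell
hodgecm-mathlib, crux H413; CENSUS-LAWS-Hside §2 «NEW at `N = 2`»).

* §1 `exists_rational_lastRow_eq_vecCons_two` — for `z ∈ E` with `z + c z = 0` the LOWER unitriangular matrix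
  `[[1, 0], [z, 1]] = J n(z) J` is a rational point of `U(J₂)` with last row `(z, 1)`;
  `exists_rational_lastRow_eq_vecCons_one_zero_two` — the Weyl element `J₂` is rational with last row `e₁ = (1, 0)`
  (Rogawski (1990), §1.10 / §3.2: `U(2)`, `N = {n(b) : b + b̄ = 0}`, `w = J`).
* §2 **`exists_rational_lastRow_eq_smul_two`** — WITT FOR ISOTROPIC LINES OF `(E², J₂)`: every isotropic `ξ ≠ 0`
  (`ξ₀ c(ξ₁) + ξ₁ c(ξ₀) = 0`) is, up to a non-zero scalar, the last row of some `γ ∈ U(J₂)(F)` (case `ξ₁ ≠ 0`: scale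
  to `ξ₁ = 1`, then `ξ₀ + c ξ₀ = 0` and §1; case `ξ₁ = 0`: `ξ ∈ E e₁`, the Weyl element).
* §3 **`exists_pos_forall_exists_le_borelHeight_two`** — THE COVERING: `∃ c₀ > 0`, every `g ∈ U(J₂)(𝔸_F)` has a
  rational translate `γ g` with `H(γ g) ≥ c₀` (★ `exists_forall_exists_isotropic_vecHeight_le` at `N = 2` + §2 +
  the product formula ★ `vecHeight_smul_algebraMap`) — reduction theory of `U(2)` in the form the truncated kernel
  uses (Borel (1963), §5; Godement (1962/63), §3; Rogawski (1990), §2.1).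

## References

* J. D. Rogawski, *Automorphic Representations of Unitary Groups in Three Variables* (1990), §1.10, §2.1,
  §3.2 [Rogawski1990].
* A. Borel, *Some finiteness properties of adele groups over number fields*, Publ. Math. IHÉS 16 (1963), §5
  [Borel1963].
* R. Godement, *Domaines fondamentaux des groupes arithmétiques*, Sém. Bourbaki 257 (1962/63), §3 [Godement1964].
-/

set_option autoImplicit false

noncomputable section

open NumberField IsDedekindDomain Matrix
open scoped NNReal MatrixGroups

namespace Literature.NumberTheory.Automorphic

namespace UnitaryGroup

variable {F E : Type} [Field F] [NumberField F] [Field E] [NumberField E] [Algebra F E]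
  {c : E ≃ₐ[F] E}

/-! ## §1 Two explicit rational unitary `2 × 2` matrices -/

omit [NumberField F] [NumberField E] in
/-- `rev` on `Fin 2` (index plumbing). [cite: Rogawski1990, §1.10] -/
private theorem rev_fin_two : (0 : Fin 2).rev = 1 ∧ (1 : Fin 2).rev = 0 := ⟨rfl, rfl⟩

/-- **The lower unitriangular unitary matrix `J n(z) J = [[1, 0], [z, 1]]`**: for `z + c z = 0` it is a rational
point of `U(J₂)` whose last row is `(z, 1)` (the conjugate by the Weyl element of the upper unitriangular
`n(z) ∈ N(F)`, `N = {n(b) : b + b̄ = 0}`). [cite: Rogawski1990, §1.10] [cite: Rogawski1990, §3.2] -/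
theorem exists_rational_lastRow_eq_vecCons_two {z : E} (hz : z + c z = 0) :
    ∃ γ : (quasiSplit F E c 2).Rational,
      (fun j : Fin 2 => ((γ.1 : GL (Fin 2) E) : Matrix (Fin 2) (Fin 2) E) ⊤ j) = ![z, 1] := by
  have hcz : c z = -z := by linear_combination hz
  -- the matrix and its inverse
  set A : Matrix (Fin 2) (Fin 2) E := !![1, 0; z, 1] with hA
  set B : Matrix (Fin 2) (Fin 2) E := !![1, 0; -z, 1] with hB
  have hAB : A * B = 1 := by
    ext i j
    fin_cases i <;> fin_cases j <;> simp [hA, hB, Matrix.mul_apply, Fin.sum_univ_two]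
  have hBA : B * A = 1 := by
    ext i j
    fin_cases i <;> fin_cases j <;> simp [hA, hB, Matrix.mul_apply, Fin.sum_univ_two]
  set g : GL (Fin 2) E := ⟨A, B, hAB, hBA⟩ with hg
  have hmem : g ∈ unitaryGroupOfForm (c : E →+* E) ((StdForm.antidiagonal 2).over E) := by
    rw [mem_unitaryGroupOfForm_antidiagonal_iff_sum']
    obtain ⟨r0, r1⟩ := rev_fin_two
    intro a b
    fin_cases a <;> fin_cases b <;>
      simp [hg, hA, Fin.sum_univ_two, r0, r1, hcz, map_one, map_zero]
  refine ⟨⟨g, hmem⟩, ?_⟩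
  funext j
  have htop : (⊤ : Fin 2) = 1 := rfl
  fin_cases j <;> simp [hg, hA, htop]

/-- **The Weyl element `J₂ = antidiag(1, 1)` is a rational point of `U(J₂)`**, with last row `e₁ = (1, 0)`.
[cite: Rogawski1990, §1.10] -/
theorem exists_rational_lastRow_eq_vecCons_one_zero_two :
    ∃ w : (quasiSplit F E c 2).Rational,
      (fun j : Fin 2 => ((w.1 : GL (Fin 2) E) : Matrix (Fin 2) (Fin 2) E) ⊤ j) = ![1, 0] := by
  set A : Matrix (Fin 2) (Fin 2) E := !![0, 1; 1, 0] with hA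
  have hAA : A * A = 1 := by
    ext i j
    fin_cases i <;> fin_cases j <;> simp [hA, Matrix.mul_apply, Fin.sum_univ_two]
  set g : GL (Fin 2) E := ⟨A, A, hAA, hAA⟩ with hg
  have hmem : g ∈ unitaryGroupOfForm (c : E →+* E) ((StdForm.antidiagonal 2).over E) := by
    rw [mem_unitaryGroupOfForm_antidiagonal_iff_sum']
    obtain ⟨r0, r1⟩ := rev_fin_two
    intro a b
    fin_cases a <;> fin_cases b <;>
      simp [hg, hA, Fin.sum_univ_two, r0, r1, map_one, map_zero]
  refine ⟨⟨g, hmem⟩, ?_⟩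
  funext j
  have htop : (⊤ : Fin 2) = 1 := rfl
  fin_cases j <;> simp [hg, hA, htop]

/-! ## §2 Witt for isotropic lines of the hyperbolic plane -/

/-- **WITT'S THEOREM FOR THE ISOTROPIC LINES OF `(E², J₂)`**: every isotropic `ξ ≠ 0`
(`Σ_i ξ_i c(ξ_{rev i}) = ξ₀ c(ξ₁) + ξ₁ c(ξ₀) = 0`) is, up to a non-zero scalar `a ∈ E`, the last row `e₂ γ` of a
rational point `γ ∈ U(J₂)(F)` — `U(J₂)(F)` acts transitively on the two isotropic lines-orbits' worth of isotropic lines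
of the hyperbolic plane, the stabiliser of `E e₂` being the Borel subgroup. [cite: Rogawski1990, §1.10]
[cite: Rogawski1990, §3.2] -/
theorem exists_rational_lastRow_eq_smul_two {ξ : Fin 2 → E} (hξ : ξ ≠ 0)
    (hiso : ∑ i, ξ i * c (ξ (Fin.rev i)) = 0) :
    ∃ γ : (quasiSplit F E c 2).Rational, ∃ a : E, a ≠ 0 ∧
      (fun j : Fin 2 => ((γ.1 : GL (Fin 2) E) : Matrix (Fin 2) (Fin 2) E) ⊤ j) = a • ξ := by
  obtain ⟨r0, r1⟩ := rev_fin_two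
  have hiso' : ξ 0 * c (ξ 1) + ξ 1 * c (ξ 0) = 0 := by
    simpa [Fin.sum_univ_two, r0, r1] using hiso
  by_cases h1 : ξ 1 = 0
  · -- `ξ = (ξ₀, 0)`: the Weyl element
    have h0 : ξ 0 ≠ 0 := by
      intro h0
      apply hξ
      funext j
      fin_cases j <;> simp [h0, h1]
    obtain ⟨w, hw⟩ := exists_rational_lastRow_eq_vecCons_one_zero_two (F := F) (E := E) (c := c)
    refine ⟨w, (ξ 0)⁻¹, inv_ne_zero h0, ?_⟩
    rw [hw]
    funext j
    fin_cases j <;> simp [h0, h1]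
  · -- `ξ₁ ≠ 0`: scale to `ξ₁ = 1` and use the lower unitriangular element
    set a : E := (ξ 1)⁻¹ with ha
    have ha1 : a * ξ 1 = 1 := inv_mul_cancel₀ h1
    have hca1 : c a * c (ξ 1) = 1 := by rw [← map_mul, ha1, map_one]
    have hz : a * ξ 0 + c (a * ξ 0) = 0 := by
      rw [map_mul]
      linear_combination (a * c a) * hiso' - (a * ξ 0) * hca1 - (c a * c (ξ 0)) * ha1
    obtain ⟨γ, hγ⟩ := exists_rational_lastRow_eq_vecCons_two (F := F) hz
    refine ⟨γ, a, inv_ne_zero h1, ?_⟩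
    rw [hγ]
    funext j
    fin_cases j <;> simp [ha1]

/-! ## §3 The covering: a rational translate of bounded-below height -/

/-- `(a ξ)_𝔸 = a_𝔸 • ξ_𝔸` on `Eⁿ` (plumbing; the `Fin 3` case is ★ `principalVec_smul`).
[cite: Garrett2018, §2.2 (PDF p. 81)] -/
theorem principalVec_smul_fin {n : ℕ} (a : E) (ξ : Fin n → E) :
    principalVec E (a • ξ) = algebraMap E (AdeleRing (𝓞 E) E) a • principalVec E ξ := by
  funext i
  simp [principalVec_apply, map_mul, smul_eq_mul]

/-- **THE COVERING OF `U(J₂)(𝔸_F)` BY RATIONAL TRANSLATES OF THE SIEGEL DOMAIN `{H ≥ c₀}`.** There is `c₀ > 0`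
such that every `g ∈ U(J₂)(𝔸_F)` has a translate `γ g`, `γ ∈ U(J₂)(F)`, with `H(γ g) ≥ c₀` (`H = borelHeight`, the
Iwasawa height `h(e₂ g)⁻¹`): an isotropic rational vector `ξ` of height `h(ξ g) ≤ B` (★
`exists_forall_exists_isotropic_vecHeight_le`, `N = 2`) is `a · e₂ γ` (§2), and `h(e₂ γ g) = h(a⁻¹ ξ g) = h(ξ g)` by the
product formula. Reduction theory for `U(2)` (Borel (1963), §5): with the `N = 2` Siegel property (the twin of ★
`borelHeight_mul_borelHeight_le_one_of_not_mem_arithmeticBorel`), `G(𝔸_F) = G(F) · {H ≥ c₀}`.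
[cite: Rogawski1990, §2.1 (p. 12)] [cite: Borel1963, §5] -/
theorem exists_pos_forall_exists_le_borelHeight_two :
    ∃ c₀ : ℝ≥0, 0 < c₀ ∧ ∀ g : (quasiSplit F E c 2).Adelic,
      ∃ γ : (quasiSplit F E c 2).Rational, c₀ ≤ borelHeight ((quasiSplit F E c 2).toAdelic γ * g) := by
  classical
  obtain ⟨B, hB⟩ := exists_forall_exists_isotropic_vecHeight_le (F := F) (E := E) (c := c) (N := 2) le_rfl
  have hB1 : 0 < max B 1 := lt_of_lt_of_le zero_lt_one (le_max_right _ _)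
  refine ⟨(max B 1)⁻¹, inv_pos.2 hB1, fun g => ?_⟩
  obtain ⟨ξ, hξ, hiso, hle⟩ := hB g
  obtain ⟨γ, a, ha, hrow⟩ := exists_rational_lastRow_eq_smul_two hξ hiso
  refine ⟨γ, ?_⟩
  have hlast : lastRow ((quasiSplit F E c 2).toAdelic γ * g) =
      algebraMap E (AdeleRing (𝓞 E) E) a •
        (principalVec E ξ ᵥ* (adelicVal F E c 2 _ g : Matrix (Fin 2) (Fin 2) (AdeleRing (𝓞 E) E))) := by
    rw [lastRow_mul, lastRow_toAdelic, hrow, principalVec_smul_fin, Matrix.smul_vecMul]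
  have hfin : IsHeightFinite E
      (principalVec E ξ ᵥ* (adelicVal F E c 2 _ g : Matrix (Fin 2) (Fin 2) (AdeleRing (𝓞 E) E))) :=
    isHeightFinite_principalVec_vecMul hξ _
  have hh : vecHeight E (lastRow ((quasiSplit F E c 2).toAdelic γ * g)) =
      vecHeight E (principalVec E ξ ᵥ* (adelicVal F E c 2 _ g : Matrix (Fin 2) (Fin 2) (AdeleRing (𝓞 E) E))) := by
    rw [hlast]
    exact vecHeight_smul_algebraMap hfin (Units.mk0 a ha)
  -- positivity of the height of a non-zero rational vector
  have hpos : 0 < vecHeight E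
      (principalVec E ξ ᵥ* (adelicVal F E c 2 _ g : Matrix (Fin 2) (Fin 2) (AdeleRing (𝓞 E) E))) := by
    have h1 := one_le_matHeightBound_mul_vecHeight (K := E) hξ (adelicVal F E c 2 _ g)
    by_contra h
    rw [not_lt, le_zero_iff] at h
    rw [h, mul_zero] at h1
    exact absurd h1 (not_le.2 zero_lt_one)
  rw [borelHeight_def, hh]
  exact inv_anti₀ hpos (hle.trans (le_max_left _ _))

end UnitaryGroup

end Literature.NumberTheory.Automorphic
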